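import Mathlib
import Summits.Ventures.LatticeQCDFlow.Scaling.GroupLayerHaar
import Summits.Ventures.LatticeQCDFlow.TrivializingMaps.HaarTraceMomentsSUn
import Summits.Ventures.LatticeQCDFlow.TrivializingMaps.PlaquetteHaarMoments
import Summits.Ventures.LatticeQCDFlow.TrivializingMaps.WilsonSU2FisherZeroRadius
import Literature.MathematicalPhysics.QuantumLattice.GaugeGroups

/-!
# LatticeQCDFlow / Scaling — the ONE-LINK DATA of the fundamental representation of `SU(N)`:
# `∫ Re tr g · g_{ab} dg = (m₂(N)/N) δ_{ab}`, `θ = 1/(2N)` for `N ≥ 3`, `θ = 1/2` for `SU(2)`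

HONEST FRAMING: exact (Metropolis-corrected) sampling algorithms for lattice gauge theory;
figures of merit are autocorrelation/cost numbers at stated couplings and volumes; no
continuum-physics claim.

Venture `LatticeQCDFlow` (cell pub-lqcd), topic `Scaling`, FANOUT row 30 (lean-1) — OUR WORK, file
9 of the extension of the slab-chain proof of (LC)/(U′) to a general compact gauge group: the
hypothesis `OneLink ρ θ` of `Scaling/GroupLayerHaar.lean` DISCHARGED for `G = SU(N)`, `ρ` the
fundamental representation `fundamentalRep (Fin N)` (the tree's
`Literature.MathematicalPhysics.QuantumLattice.GaugeGroups`), `N ≥ 2`, WITHOUT Peter–Weyl — only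
translation / conjugation / inversion invariance of Haar measure under the explicit elements
`dPairHom`, `sSwap` of `GaugeGroupsProofs` and lean-2's trace moments
(`TrivializingMaps/HaarTraceMomentsSUn.lean`, `PlaquetteHaarMoments.lean`,
`WilsonSU2FisherZeroRadius.lean`):
* `trace_inv_SU` — `tr g⁻¹ = conj tr g`;
* `integral_trRe_mul_entry_eq_zero_of_ne` — `∫ Re tr g · g_{ab} dg = 0` for `a ≠ b` (conjugation
  by `diag(i, −i)` in the `(a, b)` slots multiplies `g_{ab}` by `−1`);
* `integral_trRe_mul_diag_eq` — `∫ Re tr g · g_{aa} dg` does not depend on `a` (conjugation by the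
  signed transposition `sSwap a b`);
* `integral_trRe_mul_trace_SU`, `sum_integral_trRe_mul_diag` — `Σ_a ∫ Re tr g · g_{aa} = ∫ (Re tr g)²` (inversion invariance);
* **`oneLink_fundamentalRep`** — `OneLink (fundamentalRep (Fin N)) (m₂(N)/N)` for `N ≥ 2`, with
  `m₂(N) = ∫ (Re tr g)² dg`; **`oneLink_fundamentalRep_of_three_le`** (`θ = 1/(2N)`, `N ≥ 3`) and
  **`oneLink_fundamentalRep_two`** (`θ = 1/2`): the input that turns
  `Scaling/GroupCrossCutFloorAllT.lean` into (LC)/(U′) for `SU(N)` with the printed tube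
  coefficient `2^{-(4t+1)} N^{-4t}` [cite: MontvayMunster1994, §3.6.2 (3.437)].
Elementary; nothing is cited as a fact; `def` `sunM2`; no `sorry`.
-/

noncomputable section

open MeasureTheory Filter Finset Matrix
open Literature.MathematicalPhysics.QuantumFieldTheory
open Literature.MathematicalPhysics.QuantumLattice (fundamentalRep fundamentalRep_apply
  continuous_fundamentalRep pairFun dPairHom coe_dPairHom sSwap coe_sSwap sSwapMatrix
  coe_inv_eq_star inv_eq_conj_of_norm_eq_one)
open Summit.Ventures.LatticeQCDFlow.TrivializingMaps (integral_re_trace_haar_eq_zero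
  haarSqReTrace_eq_half haarSqReTrace_su2)

namespace Summit.Ventures.LatticeQCDFlow.Theory2.GroupLayer

variable {N : ℕ}

/-- `Re tr` of the fundamental representation is `Re tr` of the matrix. [folklore] -/
theorem trRe_fundamentalRep (g : Matrix.specialUnitaryGroup (Fin N) ℂ) :
    trRe (fundamentalRep (Fin N)) g = ((g : Matrix (Fin N) (Fin N) ℂ)).trace.re := rfl

/-- **`tr g⁻¹ = conj tr g`** on `SU(N)` (the inverse is the conjugate transpose). [folklore] -/
theorem trace_inv_SU (g : Matrix.specialUnitaryGroup (Fin N) ℂ) :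
    (fundamentalRep (Fin N) g⁻¹).trace = star (fundamentalRep (Fin N) g).trace := by
  rw [fundamentalRep_apply, fundamentalRep_apply, coe_inv_eq_star, star_eq_conjTranspose,
    trace_conjTranspose]

/-! ## 1. Off-diagonal entries: conjugation by a diagonal circle -/

/-- **`∫ Re tr g · g_{ab} dg = 0` for `a ≠ b`.** [folklore] -/
theorem integral_trRe_mul_entry_eq_zero_of_ne {a b : Fin N} (hab : a ≠ b) :
    ∫ g, (trRe (fundamentalRep (Fin N)) g : ℂ) * (g : Matrix (Fin N) (Fin N) ℂ) a b
      ∂haarProbability (Matrix.specialUnitaryGroup (Fin N) ℂ) = 0 := by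
  set μ := haarProbability (Matrix.specialUnitaryGroup (Fin N) ℂ) with hμ
  set w : Circle := ⟨Complex.I, by simp [Submonoid.unitSphere]⟩ with hwdef
  have hwI : (w : ℂ) = Complex.I := rfl
  set D : Matrix.specialUnitaryGroup (Fin N) ℂ := dPairHom a b w with hD
  have key := integral_haar_conj_eq (G := Matrix.specialUnitaryGroup (Fin N) ℂ)
    (fun g => (trRe (fundamentalRep (Fin N)) g : ℂ) * (g : Matrix (Fin N) (Fin N) ℂ) a b) D D⁻¹
  -- the `(a, b)` entry of `D g D⁻¹` is `w · g_{ab} · w = - g_{ab}`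
  have hentry : ∀ g : Matrix.specialUnitaryGroup (Fin N) ℂ,
      ((D * g * D⁻¹ : Matrix.specialUnitaryGroup (Fin N) ℂ) : Matrix (Fin N) (Fin N) ℂ) a b =
        -(g : Matrix (Fin N) (Fin N) ℂ) a b := by
    intro g
    rw [Submonoid.coe_mul, Submonoid.coe_mul, coe_inv_eq_star, hD, coe_dPairHom,
      star_eq_conjTranspose, diagonal_conjTranspose, mul_diagonal, diagonal_mul]
    have hpa : pairFun a b (w : ℂ) a = Complex.I := by
      simp [pairFun, hab, hwI]
    have hpb : (star (pairFun a b (w : ℂ))) b = Complex.I := by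
      simp only [Pi.star_apply, pairFun, Pi.mul_apply, Pi.mulSingle_apply, Ne.symm hab, if_false,
        if_true, one_mul, hwI, Complex.inv_I, star_neg, Complex.star_def, Complex.conj_I, neg_neg]
    rw [hpa, hpb]
    ring_nf
    rw [Complex.I_sq]
    ring
  have htr : ∀ g : Matrix.specialUnitaryGroup (Fin N) ℂ,
      trRe (fundamentalRep (Fin N)) (D * g * D⁻¹) = trRe (fundamentalRep (Fin N)) g :=
    fun g => trRe_conj _ D g
  simp only [hentry, htr, mul_neg, integral_neg] at key
  -- `-I = I` forces `I = 0`
  have h2 : (2 : ℂ) * ∫ g, (trRe (fundamentalRep (Fin N)) g : ℂ) * (g : Matrix (Fin N) (Fin N) ℂ) a b ∂μ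
      = 0 := by linear_combination -key
  exact (mul_eq_zero.1 h2).resolve_left two_ne_zero

/-! ## 2. Diagonal entries: conjugation by a signed transposition -/

/-- The `(a, a)` entry of `S g S⁻¹` for the signed transposition `S = sSwap a b` is `g_{bb}`.
[folklore] -/
theorem sSwap_conj_apply_diag {a b : Fin N} (hab : a ≠ b) (g : Matrix.specialUnitaryGroup (Fin N) ℂ) :
    ((sSwap a b * g * (sSwap a b)⁻¹ : Matrix.specialUnitaryGroup (Fin N) ℂ) :
      Matrix (Fin N) (Fin N) ℂ) a a = (g : Matrix (Fin N) (Fin N) ℂ) b b := by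
  rw [Submonoid.coe_mul, Submonoid.coe_mul, coe_inv_eq_star, coe_sSwap]
  unfold sSwapMatrix
  rw [if_neg hab]
  set s : Fin N → ℂ := Function.update 1 a (-1) with hs
  have hstar : star s = s := by
    funext i
    by_cases hi : i = a
    · subst hi; simp [hs]
    · simp [hs, hi]
  have hsa : s a = -1 := by simp [hs]
  rw [star_eq_conjTranspose, conjTranspose_mul, conjTranspose_swap, diagonal_conjTranspose, hstar,
    show diagonal s * Matrix.swap ℂ a b * (g : Matrix (Fin N) (Fin N) ℂ) * (Matrix.swap ℂ a b * diagonal s)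
      = diagonal s * ((Matrix.swap ℂ a b * (g : Matrix (Fin N) (Fin N) ℂ)) * Matrix.swap ℂ a b) *
        diagonal s by simp only [mul_assoc],
    mul_diagonal, diagonal_mul, Matrix.mul_swap_apply_left, Matrix.swap_mul_apply_left, hsa]
  ring

/-- **`∫ Re tr g · g_{aa} dg` does not depend on `a`.** [folklore] -/
theorem integral_trRe_mul_diag_eq (a b : Fin N) :
    ∫ g, (trRe (fundamentalRep (Fin N)) g : ℂ) * (g : Matrix (Fin N) (Fin N) ℂ) a a
        ∂haarProbability (Matrix.specialUnitaryGroup (Fin N) ℂ) =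
      ∫ g, (trRe (fundamentalRep (Fin N)) g : ℂ) * (g : Matrix (Fin N) (Fin N) ℂ) b b
        ∂haarProbability (Matrix.specialUnitaryGroup (Fin N) ℂ) := by
  by_cases hab : a = b
  · rw [hab]
  have key := integral_haar_conj_eq (G := Matrix.specialUnitaryGroup (Fin N) ℂ)
    (fun g => (trRe (fundamentalRep (Fin N)) g : ℂ) * (g : Matrix (Fin N) (Fin N) ℂ) a a)
    (sSwap a b) (sSwap a b)⁻¹
  have htr : ∀ g : Matrix.specialUnitaryGroup (Fin N) ℂ,
      trRe (fundamentalRep (Fin N)) (sSwap a b * g * (sSwap a b)⁻¹) = trRe (fundamentalRep (Fin N)) g :=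
    fun g => trRe_conj _ _ g
  simp only [sSwap_conj_apply_diag hab, htr] at key
  exact key.symm

/-! ## 3. The trace of the diagonal integrals -/

/-- The second moment of the character of `SU(N)`, `m₂(N) = ∫ (Re tr g)² dg`. [folklore] -/
def sunM2 (N : ℕ) : ℝ :=
  ∫ g, ((g : Matrix (Fin N) (Fin N) ℂ)).trace.re ^ 2 ∂haarProbability (Matrix.specialUnitaryGroup (Fin N) ℂ)

/-- **`∫ Re tr g · tr g dg = m₂(N)`** (inversion invariance: the imaginary part drops out).
[folklore] -/
theorem integral_trRe_mul_trace_SU :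
    ∫ g, (trRe (fundamentalRep (Fin N)) g : ℂ) * ((g : Matrix (Fin N) (Fin N) ℂ)).trace
      ∂haarProbability (Matrix.specialUnitaryGroup (Fin N) ℂ) = (sunM2 N : ℂ) := by
  set μ := haarProbability (Matrix.specialUnitaryGroup (Fin N) ℂ) with hμ
  have hc : Continuous fun g : Matrix.specialUnitaryGroup (Fin N) ℂ =>
      ((g : Matrix (Fin N) (Fin N) ℂ)).trace := continuous_subtype_val.matrix_trace
  have hcr : Continuous fun g : Matrix.specialUnitaryGroup (Fin N) ℂ =>
      (trRe (fundamentalRep (Fin N)) g : ℂ) :=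
    Complex.continuous_ofReal.comp (continuous_trRe _ (continuous_fundamentalRep (Fin N)))
  -- inversion invariance: `∫ Re tr g · tr g = ∫ Re tr g · conj tr g`
  have hinv := integral_inv_eq_self
    (fun g : Matrix.specialUnitaryGroup (Fin N) ℂ =>
      (trRe (fundamentalRep (Fin N)) g : ℂ) * ((g : Matrix (Fin N) (Fin N) ℂ)).trace) μ
  have hrew : ∀ g : Matrix.specialUnitaryGroup (Fin N) ℂ,
      (trRe (fundamentalRep (Fin N)) g⁻¹ : ℂ) * (((g⁻¹ : Matrix.specialUnitaryGroup (Fin N) ℂ) :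
        Matrix (Fin N) (Fin N) ℂ)).trace =
      (trRe (fundamentalRep (Fin N)) g : ℂ) * star ((g : Matrix (Fin N) (Fin N) ℂ)).trace := by
    intro g
    rw [trRe_inv trace_inv_SU, ← fundamentalRep_apply, trace_inv_SU, fundamentalRep_apply]
  simp only [hrew] at hinv
  -- add the two forms
  have hi1 : Integrable (fun g : Matrix.specialUnitaryGroup (Fin N) ℂ =>
      (trRe (fundamentalRep (Fin N)) g : ℂ) * ((g : Matrix (Fin N) (Fin N) ℂ)).trace) μ :=
    (hcr.mul hc).integrable_of_hasCompactSupport (HasCompactSupport.of_compactSpace _)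
  have hi2 : Integrable (fun g : Matrix.specialUnitaryGroup (Fin N) ℂ =>
      (trRe (fundamentalRep (Fin N)) g : ℂ) * star ((g : Matrix (Fin N) (Fin N) ℂ)).trace) μ :=
    (hcr.mul hc.star).integrable_of_hasCompactSupport (HasCompactSupport.of_compactSpace _)
  have hsum : ∀ g : Matrix.specialUnitaryGroup (Fin N) ℂ,
      (trRe (fundamentalRep (Fin N)) g : ℂ) * ((g : Matrix (Fin N) (Fin N) ℂ)).trace +
        (trRe (fundamentalRep (Fin N)) g : ℂ) * star ((g : Matrix (Fin N) (Fin N) ℂ)).trace =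
      2 * ((((g : Matrix (Fin N) (Fin N) ℂ)).trace.re ^ 2 : ℝ) : ℂ) := by
    intro g
    rw [trRe_fundamentalRep, ← mul_add, Complex.star_def, Complex.add_conj]
    push_cast
    ring
  have h2 : 2 * ∫ g, (trRe (fundamentalRep (Fin N)) g : ℂ) * ((g : Matrix (Fin N) (Fin N) ℂ)).trace ∂μ
      = 2 * (sunM2 N : ℂ) := by
    calc 2 * ∫ g, (trRe (fundamentalRep (Fin N)) g : ℂ) * ((g : Matrix (Fin N) (Fin N) ℂ)).trace ∂μ
        = (∫ g, (trRe (fundamentalRep (Fin N)) g : ℂ) * ((g : Matrix (Fin N) (Fin N) ℂ)).trace ∂μ) +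
          ∫ g, (trRe (fundamentalRep (Fin N)) g : ℂ) * star ((g : Matrix (Fin N) (Fin N) ℂ)).trace ∂μ := by
          rw [hinv, two_mul]
      _ = ∫ g, ((trRe (fundamentalRep (Fin N)) g : ℂ) * ((g : Matrix (Fin N) (Fin N) ℂ)).trace +
          (trRe (fundamentalRep (Fin N)) g : ℂ) * star ((g : Matrix (Fin N) (Fin N) ℂ)).trace) ∂μ :=
          (integral_add hi1 hi2).symm
      _ = ∫ g, (2 : ℂ) * ((((g : Matrix (Fin N) (Fin N) ℂ)).trace.re ^ 2 : ℝ) : ℂ) ∂μ :=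
          integral_congr_ae (Eventually.of_forall hsum)
      _ = 2 * (sunM2 N : ℂ) := by
          rw [integral_const_mul, integral_complex_ofReal, sunM2]
  exact mul_left_cancel₀ two_ne_zero h2

/-- **`Σ_a ∫ Re tr g · g_{aa} dg = m₂(N)`.** [folklore] -/
theorem sum_integral_trRe_mul_diag :
    ∑ a : Fin N, ∫ g, (trRe (fundamentalRep (Fin N)) g : ℂ) * (g : Matrix (Fin N) (Fin N) ℂ) a a
      ∂haarProbability (Matrix.specialUnitaryGroup (Fin N) ℂ) = (sunM2 N : ℂ) := by
  have hint : ∀ a : Fin N, Integrable (fun g : Matrix.specialUnitaryGroup (Fin N) ℂ =>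
      (trRe (fundamentalRep (Fin N)) g : ℂ) * (g : Matrix (Fin N) (Fin N) ℂ) a a)
      (haarProbability (Matrix.specialUnitaryGroup (Fin N) ℂ)) := fun a =>
    integrable_trRe_mul_entry (continuous_fundamentalRep (Fin N)) a a
  rw [← integral_trRe_mul_trace_SU, ← integral_finsetSum _ fun a _ => hint a]
  refine integral_congr_ae (Eventually.of_forall fun g => ?_)
  simp only [Matrix.trace, Matrix.diag, Finset.mul_sum]

/-! ## 4. The one-link data of `SU(N)` -/

/-- **The diagonal one-link integral**: `∫ Re tr g · g_{aa} dg = m₂(N)/N` (`N ≥ 1`). [folklore] -/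
theorem integral_trRe_mul_diag [NeZero N] (a : Fin N) :
    ∫ g, (trRe (fundamentalRep (Fin N)) g : ℂ) * (g : Matrix (Fin N) (Fin N) ℂ) a a
      ∂haarProbability (Matrix.specialUnitaryGroup (Fin N) ℂ) = ((sunM2 N / N : ℝ) : ℂ) := by
  have h := sum_integral_trRe_mul_diag (N := N)
  rw [Finset.sum_congr rfl fun b _ => integral_trRe_mul_diag_eq b a, sum_const, card_univ,
    Fintype.card_fin, nsmul_eq_mul] at h
  have hN : (N : ℂ) ≠ 0 := Nat.cast_ne_zero.2 (NeZero.ne N)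
  push_cast
  field_simp
  rw [mul_comm] at h
  exact h

/-- **THE ONE-LINK DATA OF `SU(N)`, `N ≥ 2`**: the fundamental representation is continuous,
`tr g⁻¹ = conj tr g`, `∫ Re tr = 0`, and `∫ Re tr g · g_{ab} dg = (m₂(N)/N) δ_{ab}`. [folklore] -/
theorem oneLink_fundamentalRep (hN : 2 ≤ N) :
    OneLink (G := Matrix.specialUnitaryGroup (Fin N) ℂ) (fundamentalRep (Fin N)) (sunM2 N / N) := by
  haveI : NeZero N := ⟨by omega⟩
  refine ⟨continuous_fundamentalRep (Fin N), trace_inv_SU, ?_, fun a b => ?_⟩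
  · exact integral_re_trace_haar_eq_zero hN
  · simp_rw [fundamentalRep_apply]
    by_cases hab : a = b
    · subst hab
      rw [if_pos rfl, integral_trRe_mul_diag]
    · rw [if_neg hab, integral_trRe_mul_entry_eq_zero_of_ne hab]

/-- **`SU(N)`, `N ≥ 3`: `θ = 1/(2N)`** (`m₂(N) = 1/2`, lean-2's `haarSqReTrace_eq_half`). [folklore] -/
theorem oneLink_fundamentalRep_of_three_le (hN : 3 ≤ N) :
    OneLink (G := Matrix.specialUnitaryGroup (Fin N) ℂ) (fundamentalRep (Fin N)) (1 / (2 * N)) := by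
  have h := oneLink_fundamentalRep (N := N) (by omega)
  have hm : sunM2 N = 1 / 2 := haarSqReTrace_eq_half hN
  rw [hm] at h
  have hN0 : (N : ℝ) ≠ 0 := Nat.cast_ne_zero.2 (by omega)
  rwa [show (1 / 2 : ℝ) / N = 1 / (2 * N) by field_simp] at h

/-- **`SU(2)`: `θ = 1/2`** (`m₂(2) = 1`, lean-2's `haarSqReTrace_su2`). [folklore] -/
theorem oneLink_fundamentalRep_two :
    OneLink (G := Matrix.specialUnitaryGroup (Fin 2) ℂ) (fundamentalRep (Fin 2)) (1 / 2) := by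
  have h := oneLink_fundamentalRep (N := 2) le_rfl
  have hm : sunM2 2 = 1 := haarSqReTrace_su2
  rw [hm] at h
  norm_num at h
  exact h

end Summit.Ventures.LatticeQCDFlow.Theory2.GroupLayer

end
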